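/-
Copyright (c) 2026 the pub-hodgecm-mathlib formalisation cell (harness21).  Prover seat hodgecm-mathlib-K2E3-p06 (g4), Track B «K2-LIT», engine E3, unit U4 «Keys»; deal (D61)
LINE LEAD of the open leaf (U4f-χ₁-ram-one), design D-I v2, plan step Z3-d «THE SHELL SERIES: `G₁ = ε(q−1)q⁻²·Y∕(1+Y)`, `G₂ = −ε(q−1)q⁻²∕(1+Y)`» — generic series algebra; 2026-09-04.
KERNEL module: THEOREMS ONLY (no definition, no named fact, no `sorry`, no instance, no notation).
-/
import Mathlib.Analysis.SpecificLimits.Normed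
import Mathlib.Analysis.Complex.Basic
import HarnessLib

/-!
# K2 ∕ E3 «EllipticInputs», unit U4 «Keys» — (U4f-χ₁-ram-one-d0B) step Z3-d: THE SHELL SERIES OF THE INTERTWINING MATRIX IN BRANCH B
# «`Σ_{m≥1} (−1)^{m+1} c Y^m = c·Y∕(1+Y)` and `Σ_{m≥1} (−1)^m c Y^{m−1} = −c∕(1+Y)` for `|Y| < 1`»   [Keys1984 §7; PAPER-Z3-DepthZeroInert §1 (K2E3-p06 (g4), r01-screened)]

Cell hodgecm-mathlib (D-0151), FLOOR 0, Track B «K2-LIT», engine E3, crux item H413 = stmt-HodgeConjecture-24833 (route `HCCMUnconditional`, no route verbs); target BY NAME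
the OPEN leaf `…K2E3EllipticInputs.U4Keys.sig_K2E3KeysThmTwoContractingRamifiedCharOne` (U4Keys ED. 7), Branch B at depth zero (cand v5 leaf (U4f-χ₁-ram-one-d0B)).  Author K2E3-p06 (g4),
line lead (D61).  `--supports stmt-HodgeConjecture-24833 --as helper`; THEOREMS ONLY.  NOT THE PAYER.

THE POINT.  PAPER-Z3 §1: at an inert place with residue cardinality `q`, `|2| = 1`, the off-diagonal entries of the `2×2` intertwining matrix on the `(I, χ̃)`-plane are shell sums
`G = Σ_{m≥1} I_m X^m` with shell integrals `I_m = (−1)^{m+1} ε (q−1) q^{2m−2}` and `X = χ₁(ϖ) q^{−2s−2}`; in the variable `Y = q² X = χ₁(ϖ)q^{−2s}` (`|Y| < 1`, contracting) these are the two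
geometric series of THIS FILE with `c = ε(q−1)q⁻²`: `G₁ = c·Y∕(1+Y)` and `G₂ = −c∕(1+Y)`, feeding ★ Z4 `K2E3BranchBDeterminantRoots` (`det M ∝ (qY+1)(Y+q)`).  Pure series algebra in a
complete normed field (stated over `ℂ`); Mathlib's `hasSum_geometric_of_norm_lt_one` at `ξ = −Y`.
* §1 `hasSum_neg_pow` (`Σ_{m≥0} (−Y)^m = (1+Y)⁻¹`), `one_add_ne_zero_of_norm_lt_one`.
* §2 **`hasSum_alternating_shell_one`** (`Σ_{m≥0} (−1)^m c Y^{m+1} = c·Y·(1+Y)⁻¹`, i.e. `Σ_{m≥1} (−1)^{m+1} c Y^m`), **`hasSum_alternating_shell_two`** (`Σ_{m≥0} (−1)^{m+1} c Y^m = −c·(1+Y)⁻¹`).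
HONEST LABEL: HC_CM is proved only modulo the 7 printed citations (2 remaining named inputs: hLiu418 = stmt-HodgeConjecture-24832, h413 = stmt-HodgeConjecture-24833)
until rung 0 closes; count-neutral — this file does NOT pay the leaf; no printed citation is discharged.

## References
* [Keys1984] D. Keys, Compositio Math. 51 (1984), §7 Theorem (2), §4–§6 (the rank-one intertwining computation).
* [Rogawski1990] J. Rogawski, Ann. of Math. Stud. 123 (1990), §12.2 p. 173.
-/

set_option autoImplicit false
-- the mandated namespace has the single-problem summit's repeated segment (`HodgeConjecture.HodgeConjecture`)
set_option linter.dupNamespace false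

namespace Summit.HodgeConjecture.HodgeConjecture.Cruxes.H413.K2E3BranchBShellSeries

/-! ## §1 The geometric series in `−Y` -/

/-- `1 + Y ≠ 0` for `|Y| < 1`. [cite: Keys1984, §7 Theorem (2)] -/
theorem one_add_ne_zero_of_norm_lt_one (Y : ℂ) (hY : ‖Y‖ < 1) : 1 + Y ≠ 0 := by
  intro h
  have hYeq : Y = -1 := by linear_combination h
  rw [hYeq, norm_neg, norm_one] at hY
  exact lt_irrefl _ hY

/-- `Σ_{m≥0} (−Y)^m = (1+Y)⁻¹` for `|Y| < 1` (Mathlib's geometric series at `ξ = −Y`). [cite: Keys1984, §7 Theorem (2)] -/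
theorem hasSum_neg_pow (Y : ℂ) (hY : ‖Y‖ < 1) : HasSum (fun m : ℕ => (-Y) ^ m) (1 + Y)⁻¹ := by
  have h := hasSum_geometric_of_norm_lt_one (ξ := -Y) (by rwa [norm_neg])
  rwa [sub_neg_eq_add] at h

/-! ## §2 The two alternating shell series -/

/-- **`Σ_{m≥0} (−1)^m · c · Y^{m+1} = c·Y·(1+Y)⁻¹`** (`= Σ_{m≥1} (−1)^{m+1} c Y^m`, the series `G₁∕` of PAPER-Z3 §1 in the variable `Y`), `|Y| < 1`. [cite: Keys1984, §7 Theorem (2)] -/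
theorem hasSum_alternating_shell_one (c Y : ℂ) (hY : ‖Y‖ < 1) :
    HasSum (fun m : ℕ => (-1) ^ m * c * Y ^ (m + 1)) (c * Y * (1 + Y)⁻¹) := by
  have h := (hasSum_neg_pow Y hY).mul_left (c * Y)
  refine h.congr_fun fun m => ?_
  rw [neg_pow, pow_succ]
  ring

/-- **`Σ_{m≥0} (−1)^{m+1} · c · Y^m = −c·(1+Y)⁻¹`** (`= Σ_{m≥1} (−1)^m c Y^{m−1}`, the series `G₂` of PAPER-Z3 §1 in the variable `Y`), `|Y| < 1`. [cite: Keys1984, §7 Theorem (2)] -/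
theorem hasSum_alternating_shell_two (c Y : ℂ) (hY : ‖Y‖ < 1) :
    HasSum (fun m : ℕ => (-1) ^ (m + 1) * c * Y ^ m) (-c * (1 + Y)⁻¹) := by
  have h := (hasSum_neg_pow Y hY).mul_left (-c)
  refine h.congr_fun fun m => ?_
  rw [neg_pow, pow_succ]
  ring

/-- The `tsum` forms. [cite: Keys1984, §7 Theorem (2)] -/
theorem tsum_alternating_shell (c Y : ℂ) (hY : ‖Y‖ < 1) :
    (∑' m : ℕ, (-1) ^ m * c * Y ^ (m + 1)) = c * Y * (1 + Y)⁻¹ ∧ (∑' m : ℕ, (-1) ^ (m + 1) * c * Y ^ m) = -c * (1 + Y)⁻¹ :=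
  ⟨(hasSum_alternating_shell_one c Y hY).tsum_eq, (hasSum_alternating_shell_two c Y hY).tsum_eq⟩

end Summit.HodgeConjecture.HodgeConjecture.Cruxes.H413.K2E3BranchBShellSeries
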